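import Mathlib
import Literature.Analysis.FluidPDE.IsometryInvariance
import Literature.Geometry.DiscreteGeometry.LayerShells
import Summits.NavierStokesRegularity.NavierStokesRegularity.Theorems.ThreadingFluxHorizonTowerZonalDescent
import Summits.NavierStokesRegularity.NavierStokesRegularity.Theorems.ThreadingFluxHorizonTowerZonalTheta
import Summits.NavierStokesRegularity.NavierStokesRegularity.Theorems.ThreadingFluxHorizonTowerZonalBridge
import Summits.NavierStokesRegularity.NavierStokesRegularity.Theorems.ThreadingFluxHorizonTowerZonalIsotropicAxis
import Summits.NavierStokesRegularity.NavierStokesRegularity.Theorems.ThreadingFluxHorizonTowerZonalFrame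
import Summits.NavierStokesRegularity.NavierStokesRegularity.Theorems.ThreadingFluxHorizonTowerL2DetReduction
import HarnessLib
/-!
# Crux `PoloidalLiouville` (stmt-NavierStokesRegularity-1222, wall W1), crux idea «horizon-threading-tower» (ns-idea-15):
# ALL-DEGREE horizon zonality, kernel part F6 — ASSEMBLY: `HorizonZonalitySingleDegree` BY NAME, all degrees

Support file (Theorems-side tooling; seat ns-wall-eng-5 g4, cell ns-wall-extremal, W1 adjunct; `--supports stmt-NavierStokesRegularity-1222
--as helper`).  Memo of record: pub/ns-wall-extremal/ARM-B/zonal-eng5/PROOF-HZSD-ALL-L.md (DATUM B-w5.8; paper proof critic-replicated by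
ns-wall-crit-1 g2 2026-08-28T22:52:10Z); one-file kernel proof AllDev-HorizonZonalitySingleDegree.lean 53719c2c2d5f6cf4 of which this is a slice.

Content (kernel plan F6): `eval_pi_single_of_isHomogeneous` (a homogeneous polynomial evaluated on one axis), memo Lemma E in kernel form
(`eval_theta_V` / `eval_theta_W`: the `V^l` / `W^l` coefficients of `θq` are `2^{-l} q_ℂ(1, ±i, 0)`), conjugation for real polynomials,
injectivity of `θ` (`thetaInv`), ★ `rotP_eq_zero_of_real` (a real homogeneous `q` with `Δq = 0`, `D(q) = 0`, `q_ℂ(1,i,0) = 0` has `x₀∂₁q − x₁∂₀q = 0`),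
★ `Zonal.detZonal_allDegrees` (memo THEOREM A: det-zonality ⇒ zonal, every `l ≥ 2`) and ★★ `HorizonTower.horizonZonalitySingleDegree :
HorizonZonalitySingleDegree` — the Defs Prop (ThreadingFluxHorizonTowerDefs l.252) BY NAME via `horizonZonalitySingleDegree_of_detZonal` (p673002).

HONEST LABEL: a lemma toward / part of the kernel proof of the crux-idea obstruction `HorizonTower.HorizonZonalitySingleDegree` (all `l`);
`PoloidalLiouville` (1222), `UnthreadedRigidity` (27585), the NS-dynamics levers `OrderTwoHorizonLaw(Blowdown)` and NS regularity remain OPEN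
and untouched; W1/W2 movement 0.  [folklore]
-/

-- the summit and its single problem share the name (D-0017 nested layout)
set_option linter.dupNamespace false

noncomputable section

open MvPolynomial Finsupp Complex
open scoped RealInnerProductSpace
open Literature.Analysis.FluidPDE (cross)
open Literature.Geometry.DiscreteGeometry (inner_fin3 norm_sq_fin3)

namespace Summit.NavierStokesRegularity.NavierStokesRegularity.Theorems.PoloidalLiouville.HorizonTower.Zonal

/-! ### Assembly (F6): Lemma E at the evaluation points, conjugation, injectivity of `θ`, and the theorem -/

section Assembly

/-- Evaluation of a homogeneous polynomial at a point supported on one variable picks out one coefficient. [folklore] -/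
theorem eval_pi_single_of_isHomogeneous {K : Type*} [CommRing K] {P : MvPolynomial (Fin 3) K} {n : ℕ}
    (hP : P.IsHomogeneous n) (i : Fin 3) (c : K) :
    eval (Pi.single i c) P = c ^ n * coeff (Finsupp.single i n) P := by
  classical
  rw [eval_eq']
  rw [Finset.sum_eq_single (Finsupp.single i n)]
  · rw [mul_comm]
    congr 1
    rw [Fin.prod_univ_three]
    fin_cases i <;> simp
  · intro d hd hne
    -- some `j ≠ i` has `d j ≠ 0` (else `d = single i n` by homogeneity)
    have hdeg : d 0 + d 1 + d 2 = n := by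
      have := hP (MvPolynomial.mem_support_iff.mp hd)
      rw [weight_one_fin3] at this
      exact this
    by_cases h : ∀ j, j ≠ i → d j = 0
    · exfalso; apply hne
      ext j
      by_cases hji : j = i
      · subst hji
        rw [Finsupp.single_eq_same]
        fin_cases j
        · have h1 := h 1 (by decide); have h2 := h 2 (by decide); simp at h1 h2 ⊢; omega
        · have h0 := h 0 (by decide); have h2 := h 2 (by decide); simp at h0 h2 ⊢; omega
        · have h0 := h 0 (by decide); have h1 := h 1 (by decide); simp at h0 h1 ⊢; omega
      · rw [Finsupp.single_eq_of_ne hji, h j hji]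
    · push Not at h
      obtain ⟨j, hji, hj⟩ := h
      apply mul_eq_zero_of_right
      rw [Fin.prod_univ_three]
      fin_cases j <;> fin_cases i <;> simp_all
  · intro h
    rw [MvPolynomial.notMem_support_iff.mp h, zero_mul]

/-- Evaluation of `θ q` at `(W,V,Z) = (0,2,0)` is evaluation of `q` at the isotropic point `(1, i, 0)` (memo Lemma E). -/
theorem eval_theta_V (q : MvPolynomial (Fin 3) ℂ) : eval (Pi.single 1 2) (theta q) = eval ![1, I, 0] q := by
  rw [theta]
  change eval₂Hom (RingHom.id ℂ) (Pi.single 1 2) (bind₁ thetaFun q) = _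
  rw [eval₂Hom_bind₁]
  change eval (fun i => eval (Pi.single 1 2) (thetaFun i)) q = _
  have harg : (fun i => eval (Pi.single (1 : Fin 3) (2 : ℂ)) (thetaFun i)) = ![1, I, 0] := by
    funext i; fin_cases i <;> simp
  rw [harg]

/-- Evaluation of `θ q` at `(W,V,Z) = (2,0,0)` is evaluation of `q` at the conjugate isotropic point `(1, −i, 0)`. -/
theorem eval_theta_W (q : MvPolynomial (Fin 3) ℂ) : eval (Pi.single 0 2) (theta q) = eval ![1, -I, 0] q := by
  rw [theta]
  change eval₂Hom (RingHom.id ℂ) (Pi.single 0 2) (bind₁ thetaFun q) = _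
  rw [eval₂Hom_bind₁]
  change eval (fun i => eval (Pi.single 0 2) (thetaFun i)) q = _
  have harg : (fun i => eval (Pi.single (0 : Fin 3) (2 : ℂ)) (thetaFun i)) = ![1, -I, 0] := by
    funext i; fin_cases i <;> simp
  rw [harg]

/-- Complex conjugation of the value of a REAL polynomial: `p_ℂ(z̄) = conj p_ℂ(z)`. [folklore] -/
theorem eval_conj_map_real (q : MvPolynomial (Fin 3) ℝ) (z : Fin 3 → ℂ) :
    eval (fun i => (starRingEnd ℂ) (z i)) (map (algebraMap ℝ ℂ) q) = (starRingEnd ℂ) (eval z (map (algebraMap ℝ ℂ) q)) := by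
  rw [eval_map, eval_map, hom_eval₂]
  congr 1
  ext r
  simp

/-- The inverse linear forms `W ↦ x₀ + i x₁`, `V ↦ x₀ − i x₁`, `Z ↦ x₂`. -/
def thetaInvFun : Fin 3 → MvPolynomial (Fin 3) ℂ := ![X 0 + C I * X 1, X 0 - C I * X 1, X 2]

/-- `θ⁻¹(W) = x₀ + i x₁`. [folklore] -/
@[simp] theorem thetaInvFun_zero : thetaInvFun 0 = X 0 + C I * X 1 := rfl
/-- `θ⁻¹(V) = x₀ − i x₁`. [folklore] -/
@[simp] theorem thetaInvFun_one : thetaInvFun 1 = X 0 - C I * X 1 := rfl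
/-- `θ⁻¹(Z) = x₂`. [folklore] -/
@[simp] theorem thetaInvFun_two : thetaInvFun 2 = X 2 := rfl

/-- The inverse substitution `θ⁻¹`. -/
def thetaInv : CPoly →ₐ[ℂ] MvPolynomial (Fin 3) ℂ := bind₁ thetaInvFun

/-- `θ⁻¹ ∘ θ = id`, hence `θ` is injective. -/
theorem thetaInv_comp_theta : thetaInv.comp theta = AlgHom.id ℂ _ := by
  refine MvPolynomial.algHom_ext fun i => ?_
  have h12 : (C (1 / 2 : ℂ) : MvPolynomial (Fin 3) ℂ) * 2 = 1 := by
    rw [show (2 : MvPolynomial (Fin 3) ℂ) = C (2 : ℂ) from (map_ofNat C 2).symm, ← C_mul, ← C_1]; congr 1; norm_num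
  have hII : (C I : MvPolynomial (Fin 3) ℂ) * C I = -1 := by rw [← C_mul, I_mul_I, C_neg, C_1]
  rw [AlgHom.comp_apply, AlgHom.id_apply]
  fin_cases i
  · simp only [Fin.zero_eta, theta_X_zero, map_mul, map_add, thetaInv, bind₁_C_right, bind₁_X_right, thetaInvFun_zero,
      thetaInvFun_one]
    linear_combination (X 0 : MvPolynomial (Fin 3) ℂ) * h12
  · simp only [Fin.mk_one, theta_X_one, map_mul, map_neg, map_sub, thetaInv, bind₁_C_right, bind₁_X_right, thetaInvFun_zero,
      thetaInvFun_one]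
    linear_combination (-2 * C (1 / 2 : ℂ) * (X 1 : MvPolynomial (Fin 3) ℂ)) * hII + (X 1 : MvPolynomial (Fin 3) ℂ) * h12
  · simp only [Fin.reduceFinMk, theta_X_two, thetaInv, bind₁_X_right, thetaInvFun_two]

/-- `θ` is injective: `θa = θb → a = b`. [folklore] -/
theorem eq_of_theta_eq (a b : MvPolynomial (Fin 3) ℂ) (h : theta a = theta b) : a = b := by
  have := congrArg thetaInv h
  rwa [← AlgHom.comp_apply, ← AlgHom.comp_apply, thetaInv_comp_theta, AlgHom.id_apply, AlgHom.id_apply] at this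

/-- `θ` preserves total degree. -/
theorem isHomogeneous_theta {q : MvPolynomial (Fin 3) ℂ} {l : ℕ} (hq : q.IsHomogeneous l) : (theta q).IsHomogeneous l := by
  have h : ∀ i : Fin 3, (thetaFun i).IsHomogeneous 1 := by
    intro i
    fin_cases i
    · exact ((isHomogeneous_X ℂ 0).add (isHomogeneous_X ℂ 1)).C_mul _
    · exact ((isHomogeneous_X ℂ 0).sub (isHomogeneous_X ℂ 1)).C_mul _
    · exact isHomogeneous_X ℂ 2
  have := hq.aeval thetaFun h
  rw [one_mul] at this
  rw [theta, ← aeval_eq_bind₁]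
  exact this

/-- **Top-weight vanishing for a real polynomial** (memo §4 in polynomial form): a real homogeneous `q` of degree `l ≥ 1` with flat
Laplacian `0`, cubic form `D(q) = 0` and `q_ℂ(1, i, 0) = 0` (no sectoral component about `e₂`) is annihilated by the rotation generator
`x₀∂₁ − x₁∂₀`. -/
theorem rotP_eq_zero_of_real {q : MvPolynomial (Fin 3) ℝ} {l : ℕ} (hq : q.IsHomogeneous l)
    (hlap : lapP q = 0) (hD : DP q = 0) (hiso : eval ![1, I, 0] (map (algebraMap ℝ ℂ) q) = 0) : rotP q = 0 := by
  set qc := map (algebraMap ℝ ℂ) q with hqc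
  set Q := theta qc with hQ
  have hQh : Q.IsHomogeneous l := isHomogeneous_theta (hq.map _)
  have hQlap : lapC Q = 0 := by rw [hQ, lapC_theta, hqc, ← map_lapP, hlap, map_zero, map_zero]
  have hQdet : detC Q = 0 := by rw [hQ, detC_theta, hqc, ← map_DP, hD, map_zero, map_zero, mul_zero]
  have hQV : coeff (Finsupp.single 1 l) Q = 0 := by
    have h := eval_pi_single_of_isHomogeneous hQh 1 2
    rw [hQ, eval_theta_V, ← hQ, hiso] at h
    have h2 : (2 : ℂ) ^ l ≠ 0 := pow_ne_zero _ two_ne_zero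
    exact (mul_eq_zero.mp h.symm).resolve_left h2
  have hQW : coeff (Finsupp.single 0 l) Q = 0 := by
    have h := eval_pi_single_of_isHomogeneous hQh 0 2
    have hconj : eval ![1, -I, 0] qc = (starRingEnd ℂ) (eval ![1, I, 0] qc) := by
      have harg : (![1, -I, 0] : Fin 3 → ℂ) = fun i => (starRingEnd ℂ) ((![1, I, 0] : Fin 3 → ℂ) i) := by
        funext i; fin_cases i <;> simp
      rw [harg, hqc, eval_conj_map_real]
    rw [hQ, eval_theta_W, hconj, ← hQ, hiso, map_zero] at h
    have h2 : (2 : ℂ) ^ l ≠ 0 := pow_ne_zero _ two_ne_zero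
    exact (mul_eq_zero.mp h.symm).resolve_left h2
  have hlam : lam Q = 0 := lam_eq_zero_of_detC hQh hQlap hQdet hQW hQV
  rw [hQ, lam_theta, neg_mul, neg_eq_zero, mul_eq_zero] at hlam
  rcases hlam with h | h
  · exact absurd (C_eq_zero.mp h) I_ne_zero
  · rw [hqc, ← map_rotP] at h
    have h0 : map (algebraMap ℝ ℂ) (rotP q) = 0 := eq_of_theta_eq _ _ (by rw [h, map_zero])
    exact map_injective _ (algebraMap ℝ ℂ).injective (by rw [h0, map_zero])

/-- ★ **Det-zonality ⇒ zonal, ALL DEGREES** (memo THEOREM A; the hypothesis of `horizonZonalitySingleDegree_of_detZonal`, p673002):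
every smooth degree-`l` homogeneous harmonic `H` on ℝ³ (`l ≥ 2`) with `⟪∇H, ∇‖∇H‖² × x⟫ ≡ 0` off the origin has the zonal form. -/
theorem detZonal_allDegrees (l : ℕ) (H : E3 → ℝ) (hl : 2 ≤ l) (hH : ContDiff ℝ (⊤ : ℕ∞) H)
    (hhom : ∀ (c : ℝ) (y : E3), H (c • y) = c ^ l * H y) (hharm : ∀ y, Laplacian.laplacian H y = 0)
    (hdet : ∀ x : E3, x ≠ 0 → ⟪gradient H x, cross (gradient (fun w : E3 => ‖gradient H w‖ ^ 2) x) x⟫ = 0) :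
    ∃ (a : E3) (g : ℝ → ℝ), a ≠ 0 ∧ ∀ y : E3, y ≠ 0 → H y = ‖y‖ ^ l * g (inner ℝ a y / ‖y‖) := by
  classical
  -- 1. `H` is a homogeneous polynomial
  obtain ⟨p, hp, hHp⟩ := exists_mvPolynomial_of_homogeneous hH hhom
  -- 2. an isotropic frame
  obtain ⟨u, v, hu, hv, huv, hzero⟩ := exists_orthonormal_isotropic_zero p hp (by omega)
  -- 3. the rotated function and its polynomial
  set K : E3 → ℝ := fun y => H ((frameIso hu hv huv).symm y) with hK
  set lin : Fin 3 → MvPolynomial (Fin 3) ℝ := fun j => ∑ i : Fin 3, C ((frameVec u v i) j) * X i with hlin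
  set q : MvPolynomial (Fin 3) ℝ := bind₁ lin p with hq
  have hqh : q.IsHomogeneous l := by
    have h1 : ∀ j, (lin j).IsHomogeneous 1 := fun j =>
      IsHomogeneous.sum _ _ _ fun i _ => (isHomogeneous_X ℝ i).C_mul _
    have := hp.aeval lin h1
    rw [one_mul] at this
    rw [hq, ← aeval_eq_bind₁]; exact this
  have hKq : ∀ y, K y = evalE q y := by
    intro y
    rw [hK, hq]
    simp only
    rw [hHp, evalE, evalE]
    change _ = eval₂Hom (RingHom.id ℝ) (fun i => y i) (bind₁ lin p)
    rw [eval₂Hom_bind₁]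
    change eval (fun i => ((frameIso hu hv huv).symm y) i) p = eval (fun j => eval (fun i => y i) (lin j)) p
    have harg : (fun i => ((frameIso hu hv huv).symm y) i) = fun j => eval (fun i => y i) (lin j) := by
      funext j
      rw [frameIso_symm_apply, hlin]
      simp [Fin.sum_univ_three]
      ring
    rw [harg]
  have hKfun : K = evalE q := funext hKq
  -- 4. the polynomial identities
  have hlapq : lapP q = 0 := by
    refine eq_zero_of_evalE_eq_zero fun y => ?_
    rw [← laplacian_evalE, ← hKfun]
    exact harmonic_comp_frameIso_symm hu hv huv hharm y
  have hDq : DP q = 0 := by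
    refine eq_zero_of_evalE_eq_zero fun y => ?_
    rw [← det_evalE, ← hKfun]
    by_cases hy : y = 0
    · -- at the origin the triple product vanishes trivially (`w × 0 = 0`)
      obtain ⟨c0, c1, c2⟩ := cross_fin3 (gradient (fun w : E3 => ‖gradient K w‖ ^ 2) y) y
      rw [inner_fin3, c0, c1, c2, hy]
      simp
    · exact detZonal_comp_frameIso_symm hu hv huv hdet y hy
  have hiso : eval ![1, I, 0] (map (algebraMap ℝ ℂ) q) = 0 := by
    rw [hq, map_bind₁]
    change eval₂Hom (RingHom.id ℂ) ![1, I, 0] (bind₁ _ _) = 0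
    rw [eval₂Hom_bind₁]
    change eval (fun j => eval ![1, I, 0] (map (algebraMap ℝ ℂ) (lin j))) (map (algebraMap ℝ ℂ) p) = 0
    have harg : (fun j => eval ![1, I, 0] (map (algebraMap ℝ ℂ) (lin j))) = fun i => ((u i : ℝ) : ℂ) + ((v i : ℝ) : ℂ) * I := by
      funext j
      rw [hlin]
      simp [Fin.sum_univ_three]
    rw [harg]
    exact hzero
  -- 5. rotation invariance of `K` about `e₂`, hence of `H` about `u × v`
  have hrot : rotP q = 0 := rotP_eq_zero_of_real hqh hlapq hDq hiso
  have hKrot : ∀ y : E3, ⟪cross (EuclideanSpace.single 2 (1 : ℝ)) y, gradient K y⟫ = 0 := by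
    intro y; rw [hKfun, rot_evalE, hrot, evalE_zero]
  have hHrot : ∀ x : E3, ⟪cross (cross u v) x, gradient H x⟫ = 0 := inner_cross_gradient_of_frame hu hv huv hKrot
  -- 6. the zonal functional form about `n = u × v`
  have hn : cross u v ≠ 0 := by
    intro h
    have h1 : ‖cross u v‖ ^ 2 = 1 := by rw [norm_cross_sq, hu, hv, huv]; norm_num
    rw [h, norm_zero] at h1
    norm_num at h1
  obtain ⟨g, hg⟩ := exists_zonalForm_of_inner_cross_gradient_eq_zero hn (hH.differentiable (by norm_cast))
    (fun c y _ => hhom c y) hHrot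
  exact ⟨cross u v, g, hn, hg⟩

end Assembly

end Zonal

/-- ★★ **`HorizonZonalitySingleDegree` — THE TYPED OBSTRUCTION OF «horizon-threading-tower», ALL DEGREES, BY NAME** (ns-wall-crit-1 V9-P4):
for every `l ≥ 2`, a smooth degree-`l` homogeneous harmonic `H` on ℝ³ whose horizon profile is annihilated by `𝔏₂` is zonal.  Proof:
eng-4 g2's reduction `horizonZonalitySingleDegree_of_detZonal` (p673002: `𝔏₂[U_H] = 0 ⇔ det(∇H, ∇‖∇H‖², x) = 0`) + the all-degree
det-zonality theorem `Zonal.detZonal_allDegrees` (memo PROOF-HZSD-ALL-L, DATUM B-w5.8: azimuthal top weight + isotropic axis).  Crux-idea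
obstruction only; `PoloidalLiouville` (1222), `UnthreadedRigidity` (27585) and NS regularity remain OPEN. -/
theorem horizonZonalitySingleDegree : HorizonZonalitySingleDegree :=
  horizonZonalitySingleDegree_of_detZonal fun l H hl hH hhom hharm hdet =>
    Zonal.detZonal_allDegrees l H hl hH hhom hharm hdet


end Summit.NavierStokesRegularity.NavierStokesRegularity.Theorems.PoloidalLiouville.HorizonTower

end
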